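import Literature.NumberTheory.EllipticCurves.KolyvaginShaIndexBound
import Literature.NumberTheory.EllipticCurves.AnalyticRank
import HarnessLib

/-!
# Kolyvagin 1989, Theorem B at `l = 2`: the Heegner index annihilates `Ш(E/ℚ)[2^∞]`

Source: V. A. Kolyvagin, *On the Mordell–Weil and Shafarevich–Tate groups for Weil elliptic curves*,
Izv. Akad. Nauk SSSR Ser. Mat. 52 (1988) no. 6, 1154–1180 = Math. USSR-Izv. **33** (1989) no. 3, 473–499
(bib key `Kolyvagin1989Izv`, doi 10.1070/im1989v033n03abeh000853). THEOREM B = Theorems B_l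
[p. 475 bottom – p. 476 top, verbatim]: "Let `D ≠ -3, -4` or `(K_D, i_D) ∉ Z`; suppose `y_D` is a point of
infinite order. Then `A(ℚ)` and `Ш(A)` are finite groups. Further, suppose `l` is such that
`ρ(G_{l^∞}) = GL₂(ℤ_l)`; `K_D ≠ ℚ(√-1), ℚ(√-2), ℚ(√-|Δ|), ℚ(√-2|Δ|)` if `l = 2`. Then `A(K_D)_{l^∞} = 0`
and `C_D·Ш(A)_{l^∞} = 0`." SETUP [p. 473–475]: `E` a Weil curve of conductor `N` with parametrisation
`γ : X_N → E`, `Δ` its discriminant (a class in `ℚ^×/ℚ^{×2}`); `D < 0` a fundamental discriminant with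
`D ≡ □ (mod 4N)`, `K_D = ℚ(√D)`; `y_D = N_{K₁/K_D}(y_{D,1}) ∈ E(K_D)` the Heegner trace over the Hilbert
class field `K₁` (the tree's `IsHeegnerPoint N W K P`: `P ↦ ∑_{[Q]} φ(τ_Q)`); `A := E` if `ε = -1` (the member
of `{E, E^D}` of EVEN analytic rank — by Gross–Zagier the one with `L(A,1) ≠ 0` once `y_D` has infinite
order) and `A := E^D` if `ε = 1`; `Ш(A) = Ш(A/ℚ)` [p. 473, p. 477, p. 486]; `C_{D,0}` := the largest `n` with
`y_D ≡ n·y′ (mod E(K_D)_tors)` for some `y′ ∈ E(K_D)`, and `C_D = C_{D,0}` when `A = E` [p. 475]. The proof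
[§3, p. 484–490] covers `l = 2` completely (p. 489–490; the four field exclusions say exactly
`K_D ⊄ ℚ(A_{2^∞})` by Prop. 16, p. 498, which lists the quadratic subfields of `ℚ(A_{2^∞})`); the
Tamagawa-type number `H` (p. 488) is absorbed into the auxiliary level `M₁ = l^{n+m}`, `m = ord_l H` —
there is NO Tamagawa-number, Manin-constant or reduction-type hypothesis. Fidelity read (lit GEN 156,
2026-08-27, page scans of the AMS translation, copy `paper:url-37f5e0bd2b6c` of W. Stein's archive):
pp. 473–477, 484–490, 498; the paper names no condition "`B₂(E, D)`" — the `l = 2` proviso is printed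
inside Theorem B_l itself as the four field exclusions.

What is vendored: the case `A = E` (i.e. `r_an(E) = 0`) at `l = 2` only, in the currency of
`KolyvaginShaIndexBound.lean` (`Kolyvagin1990_padicValNat_card_sha_le`, the ODD-`p` bound on `Ш(E/K)`):
`IsImaginaryQuadratic`, `SatisfiesHeegnerHypothesis` (every `p ∣ N` split — a special case of
`D ≡ □ (mod 4N)`), `IsHeegnerPoint`, `HasSurjectiveModNGaloisRep`, `WeierstrassCurve.sha` (of `W/ℚ`:
`Ш(E/ℚ)`), `AddSubgroup.index (AddSubgroup.zmultiples P)` = `[E(K) : ℤP]`, and `analyticRank`.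
FAITHFULNESS. Hypotheses: `D ≠ -3, -4` (the printed alternative "(K_D, i_D) ∉ Z" is dropped — a
specialisation); `ρ_{E,2^n}` onto for all `n ≥ 1` (= `ρ(G_{2^∞}) = GL₂(ℤ₂)`); the four exclusions as
`d_K ≠ -4, -8` and `d_K·(-|Δ|)`, `d_K·(-2|Δ|)` not squares in `ℚ` (`ℚ(√D) = ℚ(√m)` iff `D·m ∈ ℚ^{×2}`;
`W.Δ` of any model, the class mod squares being model-independent). Conclusions: (1) verbatim;
(2) with `C_D` replaced by the index `[E(K) : ℤP] = C_D · [E(K)_tors : E(K)_tors ∩ ℤP]`, a MULTIPLE of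
`C_D` — a weakening; for an infinite index Mathlib's `AddSubgroup.index = 0` makes (2) read `0 • x = 0`,
vacuous, never false (no junk strengthening). Size XL (Kolyvagin's Euler system of Heegner points at
`l = 2`); no `_holds`. Consumers: `Summits/BirchSwinnertonDyer/Rank1Residual/X5/HeegnerIndexDoorAtTwo.lean`
(the Heegner-index door of class X5 at `p = 2`).
-/

noncomputable section

open scoped Classical

namespace Literature.NumberTheory.EllipticCurves

open WeierstrassCurve

universe u

section Statement

variable (N : ℕ) [NeZero N] (W : WeierstrassCurve ℚ) (K : Type u) [Field K] [NumberField K]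

/-- **Kolyvagin 1989, Theorem B_l at `l = 2` (the `2`-part of "Theorem B"), for `A = E`.** Setting
(Izv. p. 473–474): `E/ℚ` a modular (Weil) elliptic curve of conductor `N` with a parametrisation
`γ : X_N → E`; `K = K_D = ℚ(√D)`, `D = d_K < 0` a fundamental discriminant with `D ≡ □ (mod 4N)` (here: the
Heegner hypothesis, every `p ∣ N` split in `K`), `D ≠ -3, -4`; `y_D = P ∈ E(K)` the Heegner point (trace to
`K` of `γ` of a Heegner point of `X_N(K₁)`, `K₁` the Hilbert class field); `y_D` of infinite order;
`ε = -1` and `A = E`, i.e. `E` is the member of `{E, E^D}` with `L(A, 1) ≠ 0` (stated as `r_an(E) = 0`);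
`C_D ∈ ℕ` the largest integer with `y_D ∈ C_D·E(K) + E(K)_tors`. THEOREM B_l (p. 475 bottom – p. 476
top, verbatim): "Let `D ≠ -3, -4` or `(K_D, i_D) ∉ Z`; suppose `y_D` is a point of infinite order. Then
`A(ℚ)` and `Ш(A)` are finite groups. Further, suppose `l` is such that `ρ(G_{l^∞}) = GL₂(ℤ_l)`;
`K_D ≠ ℚ(√-1), ℚ(√-2), ℚ(√-|Δ|), ℚ(√-2|Δ|)` if `l = 2`. Then `A(K_D)_{l^∞} = 0` and `C_D·Ш(A)_{l^∞} = 0`."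
Here `Δ = g₂³ - 27g₃²` is the discriminant of the equation of `E` (p. 475; a class in `ℚ^×/ℚ^{×2}`,
model-independent — p. 489: "the discriminant of the equation of `A` differs from `Δ` by a square in
`ℚ`"), and by Prop. 16 (p. 498) the four excluded fields are exactly the imaginary quadratic subfields
of `ℚ(E[2^∞])`, i.e. the `l = 2` proviso reads `K_D ⊄ ℚ(E[2^∞])` (p. 489). TYPED FORM (faithful up to the stated weakenings): hypotheses `ρ_{E,2^n}` onto for
every `n ≥ 1` (= `ρ(G_{2^∞}) = GL₂(ℤ₂)`), `d_K ≠ -4, -8` and `d_K·(-|Δ|)`, `d_K·(-2|Δ|)` non-squares in `ℚ`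
(= the four field exclusions); conclusion (1) `E(K)[2^∞] = 0` verbatim; conclusion (2) with `C_D`
replaced by the INDEX `[E(K) : ℤ·P]`, a MULTIPLE of `C_D` (`[E(K) : ℤP] = C_D · [E(K)_tors : E(K)_tors ∩ ℤP]`),
hence a weakening; Mathlib's junk value `index = 0` for an infinite index makes (2) vacuous, never false.
The restriction to the Heegner hypothesis and to `D ≠ -3, -4` (instead of "or `(K_D, i_D) ∉ Z`") are
specialisations of the printed hypotheses. A `Prop`-valued statement used as a hypothesis; not proved here.
[cite: Kolyvagin1989Izv, Thm. B_l (l = 2), p. 475–476; setup p. 473–475; Prop. 16 p. 498; proof §3 p. 484–490] -/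
def Kolyvagin1989_theoremB_two : Prop :=
  ∀ [W.IsElliptic] (_hK : IsImaginaryQuadratic K) (_hH : SatisfiesHeegnerHypothesis N K)
    (_h3 : NumberField.discr K ≠ -3) (_h4 : NumberField.discr K ≠ -4)
    {P : (W.baseChange K).toAffine.Point} (_hP : IsHeegnerPoint N W K P)
    (_hnt : ¬ IsOfFinAddOrder P) (_hr : W.analyticRank = 0)
    (_hρ : ∀ n : ℕ, 0 < n → W.HasSurjectiveModNGaloisRep ((2 : ℤ) ^ n))
    (_h8 : NumberField.discr K ≠ -8)
    (_hΔ₁ : ¬ IsSquare ((NumberField.discr K : ℚ) * -|W.Δ|))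
    (_hΔ₂ : ¬ IsSquare ((NumberField.discr K : ℚ) * (-(2 * |W.Δ|)))),
    (∀ (Q : (W.baseChange K).toAffine.Point) (n : ℕ), 2 ^ n • Q = 0 → Q = 0) ∧
      ∀ (x : W.sha) (n : ℕ), 2 ^ n • x = 0 → (AddSubgroup.zmultiples P).index • x = 0

end Statement

end Literature.NumberTheory.EllipticCurves

end
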